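import Summits.QuantumFields.BalabanUV.T4Continuum.Support.ShellMeasureLinearizedGammaTSharp
import Summits.QuantumFields.BalabanUV.T4Continuum.Support.ShellMeasureAverageAnalyticB7Sharp
import Summits.QuantumFields.BalabanUV.T4Continuum.Support.ShellMeasureLinearizedEndGammaTLocal

/-!
# `T4Continuum.ShellMeasureLinearizedEndGammaTSharp` — NE7c-S100 f5 «γ9″ THE SHARP W-d WINDOW»: THE W-d ENDs OF RECORD
# (S52∕S91 chart data) AND THE W-d PLUG OF RECORD (S91 f3 `slotAC_linearizedWindow_gammaT_local`) RE-FIRED BY NAME AT THE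
# SHARP PAIR `(R♯, M♯) = (1∕(16(d+1)L), ½)` CERTIFIED BY S100 f2 (leaf-06-g8, NO Schwarz-at-0)
(cell `pub-balaban`, sub-cell `t4`, spine estimate NE7c (node U5b); NE7c ROUND-2 crew, seat
`b2b-balaban-t4-ne7c-formalise-leaf-05` gen 10; row S100 (owner ruling R-ne7cp1-g35-1 (c): f1∕f2 leaf-06-g8, f3∕f4 this
seat; f5 = the one-line instances announced in the f3∕f4 PROPOSED lines, collected in one module so that nothing of this
seat's depends on f2's bytes except this file); imports f3 `ShellMeasureLinearizedGammaTSharp`, f2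
`ShellMeasureAverageAnalyticB7Sharp` and S91 f3 `ShellMeasureLinearizedEndGammaTLocal` ONLY, everything BY NAME;
[folklore]; 0 `def`, 0 `def … : Prop`, 0 sorry, 0 citations)

HONEST FRAMING.  Finite four-torus programme, rung (B)+1 only — NOT infinite volume, NOT a mass gap, NOT the Clay
problem, NOT summit progress; (B), `BetaPertHyp`, (B^μ) not consumed.  NE7c (`T4IndicatorShell.ShellWeightBound`) is
NOT PRINTED and NOT PROVED; «NE7c ⇐ the named binders».  KERNEL PLUMBING on OUR side of WALL §3 W-d: the certified pair
of f2 put into f3's generic ENDs and into S46∕S60's generic plug `slotAC_linearizedWindow_of_Q` exactly as S91 f3 does at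
S49's pair — so the W-d PLUG road's window condition `hq2`, its `D̃`-ball and the `log`-term of its slot constant now read
`Mq R♯ ½ = 1∕R♯² = 256(d+1)²L²` instead of `Mq (1∕(2816(d+1)L)) 1 = 2·2816²(d+1)²L²` (f4: slot radius ceiling
`≈ 2.7·10⁻⁷` instead of `≈ 4.4·10⁻¹²` on `T⁴` at `L = 2`).  Nothing printed is asserted ([Balaban1987RG1] p. 267 prints no
radius); everything displayed in S60∕S91 f3 stays displayed (the [dict] of the density, SM-L1∕L3∕L4 for the other terms,
SM-L5∕L6, numbers + (SM)); S49∕S52∕S60∕S91∕S97 untouched (twins); the END-II-final of record and THE ONE CALL unaffected.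
NOTHING in the countdown moves; spine PROVED 0∕9.  HONEST DEPENDENCY (cell): continuum YM on T⁴ ⇐ BetaPertH ∧ nine spine
estimates (0/9 proved); BetaPertH ⇐ (D1) ∧ (D4) ∧ CAP+tail; G-an2-4 gates asym, D1 and NE2/3/4.

CONTENT.
* §1 `QtΓ_bound_sharp` (f2's `‖Q̃‖ ≤ ½` in S52 f1's `hQM` shape); **`realForm_chartData_gammaT_sharp`** (S52's END at
  `(R♯, ½)` = f3 `realForm_chartData_gammaT_at` ∘ f2); **`realForm_chartData_gammaT_local_sharp`** (S91's located END at
  `(R♯, ½)`); **`realForm_chartData_gammaT_local_sharp_explicit`** (print's located loop binder + unitarity and NOTHING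
  ELSE: `εw♯ := R♯²∕(9b + 3R♯ + 1)` chosen, `Ψ` supplied).
* §2 **`slotAC_linearizedWindow_gammaT_local_sharp`** — S91 f3 `slotAC_linearizedWindow_gammaT_local` VERBATIM (binders,
  dictionary, SM-L rows, conclusion) with `(1∕(2816(d+1)L), 1) ↦ (1∕(16(d+1)L), ½)` in `hq2`, `hRC`, `hDball` and the
  slot constant's `log`-term; proof = S46∕S60 `slotAC_linearizedWindow_of_Q` BY NAME with (Q1♯)(Q3♯) := f2, (Q4) := f3
  `QtΓ_conj_of_analytic`, `hLQh`∕`hHop`∕`hhop` := S91 f1∕f3 as there.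
-/

noncomputable section

open Set Metric MeasureTheory

namespace Summit.QuantumFields.BalabanUV.T4Continuum.ShellMeasureLinearizedEndGammaTSharp

open scoped ENNReal NNReal
open Literature.MathematicalPhysics.QuantumFieldTheory.Balaban1983to89
open Literature.MathematicalPhysics.QuantumLattice (ZdEdge)
open B7BlockGeometry (qppBonds)
open B12HOperator267 (gammaT)
open B12AverageCorridor267 (loopW offAxis)
open T4ShellMeasure (SlotAntiConcentration)
open ShellMeasureWilsonTrace (TraceData)
open ShellMeasureWilsonMoving (MLetter mwordEval mdFro sSum lSum)
open ShellMeasureLevelAssembly (classifier weight)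
open Summit.QuantumFields.BalabanUV.Beta.LinearizingChange267FromQ (nonlin Mq)
open ShellMeasureLinearizedRealStructure (realSub incl reP)
open ShellMeasureAverageDerivative (hop_bound_nonneg)
open ShellMeasureLinearizedGammaT (QtΓ QtΓ_zero hopΓ κ𝔸 κΓ κ𝔸_invol κΓ_invol TΓ hΓ winΓ DtΓℝ)
open ShellMeasureLinearizedGammaTLocal (hopΓAt hΓAt norm_hopΓAt_le hopΓAt_star hGenAt_star_gammaT_unitary)
open ShellMeasureLinearizedGammaTSharp (QtΓ_conj_of_analytic realForm_chartData_gammaT_at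
  realForm_chartData_gammaT_local_at realForm_chartData_gammaT_local_explicit_at)
open ShellMeasureAverageAnalyticB7Sharp (analyticOnNhd_Qtilde_gammaT_sharp norm_Qtilde_gammaT_le_sharp)
open ShellMeasureLinearizedEndFromQ (slotAC_linearizedWindow_of_Q)
open ShellMeasureLinearizedEndGammaTLocal (fderiv_QtΓ_hopΓAt)

/-! ## §1 THE SHARP INSTANCES of f3's ENDs at `(R♯, M♯) = (1∕(16(d+1)L), ½)` -/

section Sharp

variable {d : ℕ} {𝔸 : Type*} [NormedRing 𝔸] [NormedAlgebra ℂ 𝔸] [CompleteSpace 𝔸] [NormOneClass 𝔸]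
  [StarRing 𝔸] [CStarRing 𝔸] [StarModule ℂ 𝔸] {L : ℕ} {c : ZdEdge d}

omit [StarRing 𝔸] [CStarRing 𝔸] [StarModule ℂ 𝔸] in
/-- (Q3♯) on the ball: `‖QtΓ L V c B‖ ≤ ½` for `‖B‖ < R♯ = 1∕(16(d+1)L)` — S100 f2 `norm_Qtilde_gammaT_le_sharp` (leaf-06-g8)
in S52 f1's `hQM` shape. [folklore] -/
theorem QtΓ_bound_sharp (hL : 0 < L) {V : ZdEdge d → 𝔸ˣ}
    (hV : ∀ b, ‖((V b : 𝔸ˣ) : 𝔸)‖ ≤ 1) (hV' : ∀ b, ‖(((V b)⁻¹ : 𝔸ˣ) : 𝔸)‖ ≤ 1) {ε : ℝ} (hε0 : 0 ≤ ε) (hε : ε ≤ 1 / 8)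
    (hWc : ∀ x ∈ offAxis L c, ‖((loopW L (fun U : ZdEdge d → 𝔸ˣ => gammaT L U) V c x : 𝔸ˣ) : 𝔸) - 1‖ ≤ ε) :
    ∀ B ∈ ball (0 : ↥(qppBonds L c) → 𝔸) (1 / (16 * ((d : ℝ) + 1) * L)), ‖QtΓ L V c B‖ ≤ 1 / 2 :=
  fun _ hB => norm_Qtilde_gammaT_le_sharp hL hV hV' hε0 hε hWc (mem_ball_zero_iff.1 hB)

variable [FiniteDimensional ℂ 𝔸] [MeasurableSpace 𝔸] [BorelSpace 𝔸] [MeasurableSpace (↥(qppBonds L c) → 𝔸)]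
  [BorelSpace (↥(qppBonds L c) → 𝔸)]

/-- **NE7c-S100 — S52's (LR)_j REAL-FORM CHART DATA FOR [B7] (15) AT THE SHARP PAIR `(1∕(16(d+1)L), ½)`**: the six
clauses of S52 `realForm_chartData_gammaT` with `Mq R♯ ½ = 1∕R♯²` in place of `Mq (1∕(2816(d+1)L)) 1` — print's
hypotheses (`hL hVu hV hV' hε0 hε hW hbud`), a window `9·Mq R♯ ½·b·εw < 1`, `3εw ≤ R♯`, a real splitting `Ψ` of `TΓ`; f3
`realForm_chartData_gammaT_at` ∘ f2's pair BY NAME. [folklore] -/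
theorem realForm_chartData_gammaT_sharp (hL : 0 < L) {V : ZdEdge d → 𝔸ˣ} (hVu : ∀ b, (V b : 𝔸) ∈ unitary 𝔸)
    (hV : ∀ b, ‖((V b : 𝔸ˣ) : 𝔸)‖ ≤ 1) (hV' : ∀ b, ‖(((V b)⁻¹ : 𝔸ˣ) : 𝔸)‖ ≤ 1) {ε : ℝ} (hε0 : 0 ≤ ε) (hε : ε ≤ 1 / 8)
    (hW : ∀ c', ∀ x ∈ offAxis L c', ‖((loopW L (fun U : ZdEdge d → 𝔸ˣ => gammaT L U) V c' x : 𝔸ˣ) : 𝔸) - 1‖ ≤ ε)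
    (hbud : (L : ℝ) ^ d / L * (24 * ε) < 1) {εw : ℝ}
    (hq : 9 * Mq (1 / (16 * ((d : ℝ) + 1) * L)) (1 / 2) * (((L : ℝ) ^ d / L) / (1 - (L : ℝ) ^ d / L * (24 * ε))) * εw < 1)
    (hRC : 3 * εw ≤ 1 / (16 * ((d : ℝ) + 1) * L))
    {Kf : Type*} [NormedAddCommGroup Kf] [NormedSpace ℝ Kf] (Ψ : (Kf × realSub (κ𝔸 𝔸)) ≃L[ℝ] realSub (κΓ 𝔸 L c))
    (hΨ : ∀ y, (Ψ.symm y).2 = TΓ L V c y) :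
    ∃ Dt : (↥(qppBonds L c) → 𝔸) → 𝔸,
      (∀ B : ↥(qppBonds L c) → 𝔸, ‖B‖ < εw →
        Dt B ∈ closedBall (0 : 𝔸) (4 * Mq (1 / (16 * ((d : ℝ) + 1) * L)) (1 / 2) * εw ^ 2) ∧
        nonlin (QtΓ L V c) (B - hopΓ hL V hε0 hε hW hV hV' hbud c (Dt B)) = Dt B ∧
        QtΓ L V c (B - hopΓ hL V hε0 hε hW hV hV' hbud c (Dt B)) = fderiv ℂ (QtΓ L V c) 0 B) ∧
      Measurable (fun B : realSub (κΓ 𝔸 L c) => B - hΓ hL V hε0 hε hW hV hV' hbud c (DtΓℝ L c Dt εw B)) ∧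
      InjOn (fun B : realSub (κΓ 𝔸 L c) => B - hΓ hL V hε0 hε hW hV hV' hbud c (DtΓℝ L c Dt εw B)) (winΓ L c εw) ∧
      (∀ B ∈ winΓ L c εw, HasFDerivWithinAt
          (fun B : realSub (κΓ 𝔸 L c) => B - hΓ hL V hε0 hε hW hV hV' hbud c (DtΓℝ L c Dt εw B))
          (ContinuousLinearMap.id ℝ (realSub (κΓ 𝔸 L c)) - (hΓ hL V hε0 hε hW hV hV' hbud c).comp
            (reP (κ𝔸 𝔸) κ𝔸_invol ∘L (fderiv ℂ Dt (incl (κΓ 𝔸 L c) B)).restrictScalars ℝ ∘L incl (κΓ 𝔸 L c)))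
          (winΓ L c εw) B) ∧
      ∀ B ∈ winΓ L c εw,
        TΓ L V c (B - hΓ hL V hε0 hε hW hV hV' hbud c (DtΓℝ L c Dt εw B)) +
          (fun y => reP (κ𝔸 𝔸) κ𝔸_invol (nonlin (QtΓ L V c) (incl (κΓ 𝔸 L c) y)))
            (B - hΓ hL V hε0 hε hW hV hV' hbud c (DtΓℝ L c Dt εw B)) = (Ψ.symm B).2 := by
  have hLr : (0 : ℝ) < L := by exact_mod_cast hL
  exact realForm_chartData_gammaT_at hL hVu hV hV' hε0 hε hW hbud (by positivity)
    (analyticOnNhd_Qtilde_gammaT_sharp hL hV hV' hε0 hε (hW c)) (QtΓ_bound_sharp hL hV hV' hε0 hε (hW c)) hq hRC Ψ hΨ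

/-- **NE7c-S100 — S91's LOCATED (LR)_j REAL-FORM CHART DATA AT THE SHARP PAIR `(1∕(16(d+1)L), ½)`** (loops AT `c`
only; p. 267's `h` := S91 f1 `hopΓAt`∕`hΓAt`); f3 `realForm_chartData_gammaT_local_at` ∘ f2's pair BY NAME. [folklore] -/
theorem realForm_chartData_gammaT_local_sharp (hL : 0 < L) {V : ZdEdge d → 𝔸ˣ} (hVu : ∀ b, (V b : 𝔸) ∈ unitary 𝔸)
    (hV : ∀ b, ‖((V b : 𝔸ˣ) : 𝔸)‖ ≤ 1) (hV' : ∀ b, ‖(((V b)⁻¹ : 𝔸ˣ) : 𝔸)‖ ≤ 1) {ε : ℝ} (hε0 : 0 ≤ ε) (hε : ε ≤ 1 / 8)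
    (hWc : ∀ x ∈ offAxis L c, ‖((loopW L (fun U : ZdEdge d → 𝔸ˣ => gammaT L U) V c x : 𝔸ˣ) : 𝔸) - 1‖ ≤ ε)
    (hbud : (L : ℝ) ^ d / L * (24 * ε) < 1) {εw : ℝ}
    (hq : 9 * Mq (1 / (16 * ((d : ℝ) + 1) * L)) (1 / 2) * (((L : ℝ) ^ d / L) / (1 - (L : ℝ) ^ d / L * (24 * ε))) * εw < 1)
    (hRC : 3 * εw ≤ 1 / (16 * ((d : ℝ) + 1) * L))
    {Kf : Type*} [NormedAddCommGroup Kf] [NormedSpace ℝ Kf] (Ψ : (Kf × realSub (κ𝔸 𝔸)) ≃L[ℝ] realSub (κΓ 𝔸 L c))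
    (hΨ : ∀ y, (Ψ.symm y).2 = TΓ L V c y) :
    ∃ Dt : (↥(qppBonds L c) → 𝔸) → 𝔸,
      (∀ B : ↥(qppBonds L c) → 𝔸, ‖B‖ < εw →
        Dt B ∈ closedBall (0 : 𝔸) (4 * Mq (1 / (16 * ((d : ℝ) + 1) * L)) (1 / 2) * εw ^ 2) ∧
        nonlin (QtΓ L V c) (B - hopΓAt hL V hε0 hε c hWc hV hV' hbud (Dt B)) = Dt B ∧
        QtΓ L V c (B - hopΓAt hL V hε0 hε c hWc hV hV' hbud (Dt B)) = fderiv ℂ (QtΓ L V c) 0 B) ∧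
      Measurable (fun B : realSub (κΓ 𝔸 L c) => B - hΓAt hL V hε0 hε c hWc hV hV' hbud (DtΓℝ L c Dt εw B)) ∧
      InjOn (fun B : realSub (κΓ 𝔸 L c) => B - hΓAt hL V hε0 hε c hWc hV hV' hbud (DtΓℝ L c Dt εw B)) (winΓ L c εw) ∧
      (∀ B ∈ winΓ L c εw, HasFDerivWithinAt
          (fun B : realSub (κΓ 𝔸 L c) => B - hΓAt hL V hε0 hε c hWc hV hV' hbud (DtΓℝ L c Dt εw B))
          (ContinuousLinearMap.id ℝ (realSub (κΓ 𝔸 L c)) - (hΓAt hL V hε0 hε c hWc hV hV' hbud).comp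
            (reP (κ𝔸 𝔸) κ𝔸_invol ∘L (fderiv ℂ Dt (incl (κΓ 𝔸 L c) B)).restrictScalars ℝ ∘L incl (κΓ 𝔸 L c)))
          (winΓ L c εw) B) ∧
      ∀ B ∈ winΓ L c εw,
        TΓ L V c (B - hΓAt hL V hε0 hε c hWc hV hV' hbud (DtΓℝ L c Dt εw B)) +
          (fun y => reP (κ𝔸 𝔸) κ𝔸_invol (nonlin (QtΓ L V c) (incl (κΓ 𝔸 L c) y)))
            (B - hΓAt hL V hε0 hε c hWc hV hV' hbud (DtΓℝ L c Dt εw B)) = (Ψ.symm B).2 := by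
  have hLr : (0 : ℝ) < L := by exact_mod_cast hL
  exact realForm_chartData_gammaT_local_at hL hVu hV hV' hε0 hε hWc hbud (by positivity)
    (analyticOnNhd_Qtilde_gammaT_sharp hL hV hV' hε0 hε hWc) (QtΓ_bound_sharp hL hV hV' hε0 hε hWc) hq hRC Ψ hΨ

/-- **NE7c-S100 — S91's LOCATED END AT THE SHARP PAIR, FULLY EXPLICIT: print's located loop binder + unitarity and
NOTHING ELSE** — `εw♯ := R♯²∕(9b + 3R♯ + 1)` CHOSEN (`= R♯²∕(18·½·b + 3R♯ + 1)`, f3 `window_ok_M`), `Ψ` SUPPLIED;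
the six clauses at that `εw♯`.  Compare S91 `realForm_chartData_gammaT_local_explicit` (`R = 1∕(2816(d+1)L)`,
`εw = R²∕(18b + 3R + 1)`): same hypotheses, window larger by `≈ 2·176²` (§6). [folklore] -/
theorem realForm_chartData_gammaT_local_sharp_explicit (hL : 0 < L) {V : ZdEdge d → 𝔸ˣ}
    (hVu : ∀ b, (V b : 𝔸) ∈ unitary 𝔸)
    (hV : ∀ b, ‖((V b : 𝔸ˣ) : 𝔸)‖ ≤ 1) (hV' : ∀ b, ‖(((V b)⁻¹ : 𝔸ˣ) : 𝔸)‖ ≤ 1) {ε : ℝ} (hε0 : 0 ≤ ε) (hε : ε ≤ 1 / 8)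
    (hWc : ∀ x ∈ offAxis L c, ‖((loopW L (fun U : ZdEdge d → 𝔸ˣ => gammaT L U) V c x : 𝔸ˣ) : 𝔸) - 1‖ ≤ ε)
    (hbud : (L : ℝ) ^ d / L * (24 * ε) < 1) :
    ∃ (εw : ℝ) (Ψ : (LinearMap.ker ((TΓ L V c : realSub (κΓ 𝔸 L c) →L[ℝ] realSub (κ𝔸 𝔸)) :
        realSub (κΓ 𝔸 L c) →ₗ[ℝ] realSub (κ𝔸 𝔸)) × realSub (κ𝔸 𝔸)) ≃L[ℝ] realSub (κΓ 𝔸 L c))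
      (Dt : (↥(qppBonds L c) → 𝔸) → 𝔸),
      εw = (1 / (16 * ((d : ℝ) + 1) * L)) ^ 2 /
          (18 * (1 / 2) * (((L : ℝ) ^ d / L) / (1 - (L : ℝ) ^ d / L * (24 * ε))) + 3 * (1 / (16 * ((d : ℝ) + 1) * L)) + 1) ∧
      (∀ y, (Ψ.symm y).2 = TΓ L V c y) ∧
      (∀ B : ↥(qppBonds L c) → 𝔸, ‖B‖ < εw →
        Dt B ∈ closedBall (0 : 𝔸) (4 * Mq (1 / (16 * ((d : ℝ) + 1) * L)) (1 / 2) * εw ^ 2) ∧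
        nonlin (QtΓ L V c) (B - hopΓAt hL V hε0 hε c hWc hV hV' hbud (Dt B)) = Dt B ∧
        QtΓ L V c (B - hopΓAt hL V hε0 hε c hWc hV hV' hbud (Dt B)) = fderiv ℂ (QtΓ L V c) 0 B) ∧
      Measurable (fun B : realSub (κΓ 𝔸 L c) => B - hΓAt hL V hε0 hε c hWc hV hV' hbud (DtΓℝ L c Dt εw B)) ∧
      InjOn (fun B : realSub (κΓ 𝔸 L c) => B - hΓAt hL V hε0 hε c hWc hV hV' hbud (DtΓℝ L c Dt εw B)) (winΓ L c εw) ∧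
      (∀ B ∈ winΓ L c εw, HasFDerivWithinAt
          (fun B : realSub (κΓ 𝔸 L c) => B - hΓAt hL V hε0 hε c hWc hV hV' hbud (DtΓℝ L c Dt εw B))
          (ContinuousLinearMap.id ℝ (realSub (κΓ 𝔸 L c)) - (hΓAt hL V hε0 hε c hWc hV hV' hbud).comp
            (reP (κ𝔸 𝔸) κ𝔸_invol ∘L (fderiv ℂ Dt (incl (κΓ 𝔸 L c) B)).restrictScalars ℝ ∘L incl (κΓ 𝔸 L c)))
          (winΓ L c εw) B) ∧
      ∀ B ∈ winΓ L c εw,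
        TΓ L V c (B - hΓAt hL V hε0 hε c hWc hV hV' hbud (DtΓℝ L c Dt εw B)) +
          (fun y => reP (κ𝔸 𝔸) κ𝔸_invol (nonlin (QtΓ L V c) (incl (κΓ 𝔸 L c) y)))
            (B - hΓAt hL V hε0 hε c hWc hV hV' hbud (DtΓℝ L c Dt εw B)) = (Ψ.symm B).2 := by
  have hLr : (0 : ℝ) < L := by exact_mod_cast hL
  exact realForm_chartData_gammaT_local_explicit_at hL hVu hV hV' hε0 hε hWc hbud (by positivity) (by norm_num)
    (analyticOnNhd_Qtilde_gammaT_sharp hL hV hV' hε0 hε hWc) (QtΓ_bound_sharp hL hV hV' hε0 hε hWc)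

end Sharp

/-! ## §2 THE W-d PLUG OF RECORD at the sharp pair -/

section Plug

variable {d : ℕ} {𝔸 : Type*} [NormedRing 𝔸] [NormedAlgebra ℂ 𝔸] [CompleteSpace 𝔸] [NormOneClass 𝔸]
  [StarRing 𝔸] [CStarRing 𝔸] [StarModule ℂ 𝔸] {L : ℕ} {c : ZdEdge d}
  [FiniteDimensional ℂ 𝔸] [MeasurableSpace 𝔸] [BorelSpace 𝔸] [MeasurableSpace (↥(qppBonds L c) → 𝔸)]
  [BorelSpace (↥(qppBonds L c) → 𝔸)]

/-- **NE7c-S100 — THE W-d PLUG OF RECORD AT THE SHARP PAIR `(1∕(16(d+1)L), ½)`.**  S91 f3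
`slotAC_linearizedWindow_gammaT_local` — statement, binders and conclusion VERBATIM — with S49's pair replaced by f2's in
the window condition `hq2 : 9·Mq R♯ ½·b·εw ≤ ½` (`⇔ εw ≤ R♯²∕(18b)`, f4 `hq2_iff_half`), the radius condition `3εw ≤ R♯`,
the `D̃`-ball `4·Mq R♯ ½·εw²` and the slot constant's `−log(1 − 18·Mq R♯ ½·b·r)`; `slotAC_linearizedWindow_of_Q` BY NAME
with (Q1♯) f2 `analyticOnNhd_Qtilde_gammaT_sharp`, (Q2) S52 f1 `QtΓ_zero`, (Q3♯) `QtΓ_bound_sharp`, (Q4) f3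
`QtΓ_conj_of_analytic`, `hLQh` := S91 f3 `fderiv_QtΓ_hopΓAt`, `hHop` := S91 f1 `norm_hopΓAt_le`, `hhop` := S91 f1
`hopΓAt_star ∘ hGenAt_star_gammaT_unitary` — all per exterior point.  Everything displayed in S60∕S91 f3 stays displayed.
[folklore] -/
theorem slotAC_linearizedWindow_gammaT_local_sharp (hL : 0 < L) (μE : Measure (realSub (κΓ 𝔸 L c))) [μE.IsAddHaarMeasure]
    {Kf : Type*} [NormedAddCommGroup Kf] [NormedSpace ℝ Kf] [MeasurableSpace Kf] [BorelSpace Kf]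
    [FiniteDimensional ℝ Kf] (μK : Measure Kf) [μK.IsAddHaarMeasure]
    {A : Type*} [NormedRing A] [NormedAlgebra ℂ A] [CompleteSpace A] [NormOneClass A]
    {Z : Type*} [MeasurableSpace Z] (ζ : Measure Z) [SFinite ζ]
    -- PRINT'S REGIME on the exterior-indexed background, `ε` uniform
    {V : Z → ZdEdge d → 𝔸ˣ} (hVu : ∀ z b, (V z b : 𝔸) ∈ unitary 𝔸)
    (hV : ∀ z b, ‖((V z b : 𝔸ˣ) : 𝔸)‖ ≤ 1) (hV' : ∀ z b, ‖(((V z b)⁻¹ : 𝔸ˣ) : 𝔸)‖ ≤ 1) {ε : ℝ} (hε0 : 0 ≤ ε)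
    (hε : ε ≤ 1 / 8)
    (hWc : ∀ z, ∀ x ∈ offAxis L c, ‖((loopW L (fun U : ZdEdge d → 𝔸ˣ => gammaT L U) (V z) c x : 𝔸ˣ) : 𝔸) - 1‖ ≤ ε)
    (hbud : (L : ℝ) ^ d / L * (24 * ε) < 1)
    -- the window radius
    {εw : ℝ} (hq2 : 9 * Mq (1 / (16 * ((d : ℝ) + 1) * L)) (1 / 2) *
      (((L : ℝ) ^ d / L) / (1 - (L : ℝ) ^ d / L * (24 * ε))) * εw ≤ 1 / 2)
    (hRC : 3 * εw ≤ 1 / (16 * ((d : ℝ) + 1) * L))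
    -- a solution of print's fixed-point equation per exterior point
    {Dt : Z → (↥(qppBonds L c) → 𝔸) → 𝔸}
    (hDball : ∀ z, ∀ B : ↥(qppBonds L c) → 𝔸, ‖B‖ < εw →
      Dt z B ∈ closedBall (0 : 𝔸) (4 * Mq (1 / (16 * ((d : ℝ) + 1) * L)) (1 / 2) * εw ^ 2))
    (hDfix : ∀ z, ∀ B : ↥(qppBonds L c) → 𝔸, ‖B‖ < εw →
      nonlin (QtΓ L (V z) c) (B - hopΓAt hL (V z) hε0 hε c (hWc z) (hV z) (hV' z) hbud (Dt z B)) = Dt z B)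
    -- the splitting along the real `DQ̃(0)` and its section
    (Ψ : Z → (Kf × realSub (κ𝔸 𝔸)) ≃L[ℝ] realSub (κΓ 𝔸 L c)) (hΨ : ∀ z y, ((Ψ z).symm y).2 = TΓ L (V z) c y)
    {σ : Z → realSub (κ𝔸 𝔸) → realSub (κΓ 𝔸 L c)} (hσm : ∀ z, Measurable (σ z))
    (hσ : ∀ z a, ((Ψ z).symm (σ z a)).2 = a)
    -- the chart by its defining equation
    {Φ : Z → realSub (κΓ 𝔸 L c) → realSub (κΓ 𝔸 L c)}
    (hΦ : ∀ z, Φ z = fun B => B - hΓAt hL (V z) hε0 hε c (hWc z) (hV z) (hV' z) hbud (DtΓℝ L c (Dt z) εw B))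
    -- the realized slot law
    {G : realSub (κΓ 𝔸 L c) × Z → ℝ≥0∞} (hG : Measurable G) {u : realSub (κΓ 𝔸 L c) × Z → ℝ} (hu : Measurable u)
    (hGsupp : ∀ z y, G (y, z) ≠ 0 → y ∈ Φ z '' {y : realSub (κΓ 𝔸 L c) | ‖incl (κΓ 𝔸 L c) y‖ < εw})
    (hfin : ∀ z a, (μK.withDensity fun x => ({y : realSub (κΓ 𝔸 L c) | ‖incl (κΓ 𝔸 L c) y‖ < εw}).indicator
      (fun y => G (Φ z y, z)) (σ z a + Ψ z (x, 0))) univ ≠ ∞)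
    -- level data per exterior point AND average value, in the fibre coordinate
    (Ttr : TraceData A) (hN : 0 < Ttr.N) {ι κ : Type*} {Pu : Finset ι} (hPu : Pu.Nonempty)
    (hol : Z → realSub (κ𝔸 𝔸) → ι → Kf → A) (hcont : ∀ z a, ∀ p ∈ Pu, Continuous (hol z a p))
    (Pw : Finset κ) (Gw : Z → realSub (κ𝔸 𝔸) → κ → Kf → A) (𝓔 : Z → realSub (κ𝔸 𝔸) → Kf → ℝ)
    (W : Z → realSub (κ𝔸 𝔸) → Set Kf) (Jco : Z → realSub (κ𝔸 𝔸) → Kf → ℝ≥0∞) {θ δ ρ β Rad H B𝓔 r : ℝ}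
    {sw lw dw : κ → ℝ}
    -- DICTIONARY at the charted point — the DENSITY ALONE
    (hFdict : ∀ z a x, ({y : realSub (κΓ 𝔸 L c) | ‖incl (κΓ 𝔸 L c) y‖ < εw}).indicator (fun y => G (Φ z y, z))
      (σ z a + Ψ z (x, 0)) = Jco z a x * weight Ttr β Pw (Gw z a) (𝓔 z a) x)
    (hudict : ∀ z a x, ({y : realSub (κΓ 𝔸 L c) | ‖incl (κΓ 𝔸 L c) y‖ < εw}).indicator (fun y => G (Φ z y, z))
      (σ z a + Ψ z (x, 0)) ≠ 0 → u (Φ z (σ z a + Ψ z (x, 0)), z) = classifier hPu (hol z a) x)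
    -- window placement
    (hWr : ∀ z a, ∀ x ∈ W z a, ‖σ z a‖ + Rad * ‖Ψ z (x, 0)‖ ≤ r) (hr0 : 0 ≤ r) (hrε : r < εw)
    -- SM-L5/L6
    (hJW : ∀ z a x, Jco z a x ≠ 0 → x ∈ W z a)
    (hJ : ∀ z a x, ∀ a' : ℝ, 0 ≤ a' → Jco z a x ≤ Jco z a (Real.exp (-a') • x))
    -- SM-L1
    (hRad : 1 < Rad)
    (hAN : ∀ z a, ∀ x ∈ W z a, ∀ p ∈ Pu, ∃ f : ℂ → A, DifferentiableOn ℂ f (ball 0 Rad) ∧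
      (∀ w ∈ ball (0 : ℂ) Rad, ‖f w‖ ≤ H) ∧ f 0 = 0 ∧
      ∀ c' : ℝ, 0 ≤ c' → c' ≤ 1 → f (c' : ℂ) = hol z a p (c' • x) - 1)
    -- SM-L3
    (hGW : ∀ z a, ∀ x ∈ W z a, ∀ p ∈ Pw, ∃ gw : List (MLetter A × ℝ × ℝ), (∀ y ∈ gw, y.1.Good Ttr.τ y.2.1 y.2.2) ∧
      sSum gw ≤ sw p ∧ lSum gw ≤ lw p ∧ mdFro (gw.map Prod.fst) ≤ dw p ∧
      ∀ c' : ℝ, 0 ≤ c' → c' ≤ 1 → mwordEval c' (gw.map Prod.fst) = Gw z a p (c' • x))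
    (hsw1 : ∀ p ∈ Pw, sw p ≤ 1) (hsw0 : ∀ p ∈ Pw, 0 ≤ sw p) (hlw0 : ∀ p ∈ Pw, 0 ≤ lw p)
    (hdw0 : ∀ p ∈ Pw, 0 ≤ dw p)
    -- SM-L4 for the OTHER terms
    (hE : ∀ z a, ∀ x ∈ W z a, ∀ c' : ℝ, 1 / 2 ≤ c' → c' ≤ 1 → 𝓔 z a (c' • x) ≤ 𝓔 z a x + (1 - c') * B𝓔)
    (hB𝓔 : 0 ≤ B𝓔)
    -- numbers + (SM)
    (hθ : 0 < θ) (hδ0 : 0 ≤ δ) (hδ1 : δ < 1) (hρ0 : 0 ≤ ρ) (hρ : ρ ≤ (1 - δ) / 2) (hβ : 0 ≤ β)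
    (hSM : 36 * H * 1 ^ 2 / (Rad - 1) ^ 2 ≤ δ * θ) :
    SlotAntiConcentration ((μE.prod ζ).withDensity G) u θ ρ
      (2 * ((Module.finrank ℝ Kf : ℝ) + (β * ∑ p ∈ Pw, lw p * (dw p + 4 * sw p) +
        (B𝓔 + 3 * (2 * (Module.finrank ℂ (↥(qppBonds L c) → 𝔸) *
          (-Real.log (1 - 18 * Mq (1 / (16 * ((d : ℝ) + 1) * L)) (1 / 2) *
            (((L : ℝ) ^ d / L) / (1 - (L : ℝ) ^ d / L * (24 * ε))) * r)))) / (Rad - 1)))) / (1 - δ)) := by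
  have hLr : (0 : ℝ) < L := by exact_mod_cast hL
  have hR : (0 : ℝ) < 1 / (16 * ((d : ℝ) + 1) * L) := by positivity
  exact slotAC_linearizedWindow_of_Q (κX := κ𝔸 𝔸) (κY := κΓ 𝔸 L c) μE μK κ𝔸_invol κΓ_invol ζ
    (Qt := fun z => QtΓ L (V z) c) (hop := fun z => hopΓAt hL (V z) hε0 hε c (hWc z) (hV z) (hV' z) hbud) hR
    (fun z => analyticOnNhd_Qtilde_gammaT_sharp hL (hV z) (hV' z) hε0 hε (hWc z)) (fun z => QtΓ_zero L (V z) c)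
    (fun z => QtΓ_bound_sharp hL (hV z) (hV' z) hε0 hε (hWc z))
    (fun z => QtΓ_conj_of_analytic hL (hVu z) (hV z) (hV' z) hε0 hε (hWc z)
      (analyticOnNhd_Qtilde_gammaT_sharp hL (hV z) (hV' z) hε0 hε (hWc z)))
    (fun z X => fderiv_QtΓ_hopΓAt hL hε0 hε (hWc z) (hV z) (hV' z) hbud X) (hop_bound_nonneg hL hbud)
    (fun z X => norm_hopΓAt_le hL (V z) hε0 hε c (hWc z) (hV z) (hV' z) hbud X)
    (fun z X => hopΓAt_star hL (V z) hε0 hε c (hWc z) (hV z) (hV' z) hbud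
      (hGenAt_star_gammaT_unitary hL (V z) hε0 hε c (hWc z) (hV z) (hV' z) hbud (hVu z)) X)
    hq2 hRC hDball hDfix Ψ hΨ hσm hσ hΦ hG hu hGsupp hfin Ttr hN hPu hol hcont Pw Gw 𝓔 W Jco hFdict hudict hWr hr0
    hrε hJW hJ hRad hAN hGW hsw1 hsw0 hlw0 hdw0 hE hB𝓔 hθ hδ0 hδ1 hρ0 hρ hβ hSM

end Plug

end Summit.QuantumFields.BalabanUV.T4Continuum.ShellMeasureLinearizedEndGammaTSharp
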